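import Summits.CriticalPhenomena.PercolationContinuityZ3.Theorems.PercNearOneGluingNoHeavyLowerTailTformGluedStarPacking
import Summits.CriticalPhenomena.PercolationContinuityZ3.Theorems.PercNearOneGluingNoHeavyLowerTailTformSetInductionChampion
import HarnessLib

/-!
# `NoHeavyLowerTail` (stmt-CriticalPhenomena-4575) — the gluing step from a SUB-CHAMPION comparison; the non-informative gluing step

Support file (prover `prim-hp-5`, hull-port cell, T-form calculus, gen 7; `--supports stmt-CriticalPhenomena-4575`).  No definitions,
no named facts, no sorries.  Setting of the residual gluing hypothesis `hGlue` of `Theorems.noHeavyLowerTail_of_gluedChampion_open`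
(file `…TformSetInductionChampion`): a weighted graph `w` on `Fin n`, relays `A`, level `j`, a champion `q`, a fallback relay `c`, a
non-relay set `B` with `2 ≤ |B|`, and the INDUCTION HYPOTHESIS — light-star packing LSP at champions for every nonempty non-relay set of
every graph with fewer positive pairs.  For a member `y ∈ B` with a positive pair let `u` = `w` with the pairs at `y` switched off and
`p` a champion of `u` (a SUB-CHAMPION).  By the induction hypothesis (and unguarded stability for stars through a relay), `p` is a
T-witness in `u` of every set `(B ∖ y) ∪ S`, `S` a star of `y`; so the glued star-packing transfer (`Theorems.gluedSet_lsp_of_reference`)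
gives:

* `gluedSet_lsp_of_subchampion` — LSP(w, q, c, B) whenever `q` is at least as light in `w/B` as the sub-champion `p`
  (`μ(G_p) ≤ μ(G_q)`, `G_x` = "`x` light in `w/B`");  in particular
* `gluedSet_lsp_of_gluedChampion` — LSP(w, q, c, B) whenever `q` is a champion of the GLUED lightness (`μ(G_a) ≤ μ(G_q)` for all
  relays `a`): the NON-INFORMATIVE case of the gluing step is discharged; what remains of `hGlue` is the case where gluing `B`
  dethrones `q` (seat memo OBSERVER-SET.md §19–20; certificates REF/REF3 under census).
-/

noncomputable section

namespace Summit.CriticalPhenomena.PercolationContinuityZ3.Theorems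

open MeasureTheory Set Literature.Probability.LatticeModels Literature.Probability.Percolation
open scoped Classical BigOperators

variable {n : ℕ}

open CutObserver KNPreFKG in
/-- **The gluing step from a sub-champion comparison.**  With the induction hypothesis of the set induction (LSP at champions for
all nonempty non-relay sets of graphs with fewer positive pairs), a member `y ∈ B` with a positive pair, `u` = `w` without the pairs
at `y` and `p` a champion of `u`: if `μ(G_p) ≤ μ(G_q)` (glued lightness) then LSP(w, q, c, B).
[cite: KozmaNitzan2024, Lemma 5 and Thm. 4 (pp. 13–14)] -/
theorem gluedSet_lsp_of_subchampion (w : Sym2 (Fin n) → unitInterval) (A B : Finset (Fin n)) (y p q c : Fin n) (j : ℕ)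
    (ih : ∀ (n' : ℕ) (w' : Sym2 (Fin n') → unitInterval) (A' B' : Finset (Fin n')) (q' c' : Fin n') (j' : ℕ),
      (Finset.univ.filter fun e : Sym2 (Fin n') => w' e ≠ 0).card < (Finset.univ.filter fun e : Sym2 (Fin n) => w e ≠ 0).card →
      q' ∈ A' → c' ∈ A' → B'.Nonempty → (∀ m ∈ B', m ∉ A') →
      (∀ a ∈ A', (prodBernoulli w').real {ω : BondConfig (Fin n') | (A'.filter fun x => ω ∈ openConn a x).card ≤ j'} ≤
        (prodBernoulli w').real {ω : BondConfig (Fin n') | (A'.filter fun x => ω ∈ openConn q' x).card ≤ j'}) →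
      (prodBernoulli w').real {ω : BondConfig (Fin n') | (∀ m ∈ B', ω ∉ openConn q' m) ∧
          1 ≤ (A'.filter fun z => ∃ m ∈ B', ω ∈ openConn m z).card ∧ (A'.filter fun z => ∃ m ∈ B', ω ∈ openConn m z).card ≤ j'} +
        (prodBernoulli w').real {ω : BondConfig (Fin n') | ¬ 1 ≤ (A'.filter fun z => ∃ m ∈ B', ω ∈ openConn m z).card ∧
          (A'.filter fun z => ω ∈ openConn c' z).card ≤ j'} ≤
      (prodBernoulli w').real {ω : BondConfig (Fin n') | (∀ m ∈ B', ω ∉ openConn q' m) ∧ (A'.filter fun z => ω ∈ openConn q' z).card ≤ j'})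
    (hqA : q ∈ A) (hcA : c ∈ A) (hBA : ∀ m ∈ B, m ∉ A) (hyB : y ∈ B) (hB2 : 2 ≤ B.card) (hy : ∃ v, v ≠ y ∧ w s(y, v) ≠ 0)
    (hpA : p ∈ A)
    (hpch : ∀ a ∈ A, (prodBernoulli fun e => if e ∈ {e : Sym2 (Fin n) | y ∉ e} then w e else 0).real
        {ξ : BondConfig (Fin n) | (A.filter fun z => ξ ∈ openConn a z).card ≤ j} ≤
      (prodBernoulli fun e => if e ∈ {e : Sym2 (Fin n) | y ∉ e} then w e else 0).real
        {ξ : BondConfig (Fin n) | (A.filter fun z => ξ ∈ openConn p z).card ≤ j})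
    (hcmp : (prodBernoulli w).real {ω : BondConfig (Fin n) |
        ((∃ m ∈ B, ω ∈ openConn p m) → (A.filter fun z => ∃ m ∈ B, ω ∈ openConn m z).card ≤ j) ∧
          ((∀ m ∈ B, ω ∉ openConn p m) → (A.filter fun z => ω ∈ openConn p z).card ≤ j)} ≤
      (prodBernoulli w).real {ω : BondConfig (Fin n) |
        ((∃ m ∈ B, ω ∈ openConn q m) → (A.filter fun z => ∃ m ∈ B, ω ∈ openConn m z).card ≤ j) ∧
          ((∀ m ∈ B, ω ∉ openConn q m) → (A.filter fun z => ω ∈ openConn q z).card ≤ j)}) :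
    (prodBernoulli w).real {ω : BondConfig (Fin n) | (∀ m ∈ B, ω ∉ openConn q m) ∧
        1 ≤ (A.filter fun z => ∃ m ∈ B, ω ∈ openConn m z).card ∧ (A.filter fun z => ∃ m ∈ B, ω ∈ openConn m z).card ≤ j} +
      (prodBernoulli w).real {ω : BondConfig (Fin n) | ¬ 1 ≤ (A.filter fun z => ∃ m ∈ B, ω ∈ openConn m z).card ∧
        (A.filter fun z => ω ∈ openConn c z).card ≤ j} ≤
      (prodBernoulli w).real {ω : BondConfig (Fin n) | (∀ m ∈ B, ω ∉ openConn q m) ∧ (A.filter fun z => ω ∈ openConn q z).card ≤ j} := by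
  haveI : IsProbabilityMeasure (prodBernoulli w) := inferInstance
  have hyA : y ∉ A := hBA y hyB
  set B' : Finset (Fin n) := B.erase y with hB'
  have hyB' : y ∉ B' := Finset.notMem_erase y B
  have hBeq : insert y B' = B := Finset.insert_erase hyB
  have hB'ne : B'.Nonempty := by
    rw [← Finset.card_pos, hB', Finset.card_erase_of_mem hyB]; omega
  have hB'B : ∀ m ∈ B', m ∈ B := fun m hm => Finset.mem_of_mem_erase hm
  -- the weights without the pairs at `y` have fewer positive pairs
  set u : Sym2 (Fin n) → unitInterval := fun e => if e ∈ {e : Sym2 (Fin n) | y ∉ e} then w e else 0 with hu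
  obtain ⟨v₀, hv₀y, hv₀⟩ := hy
  have hlt : (Finset.univ.filter fun e : Sym2 (Fin n) => u e ≠ 0).card <
      (Finset.univ.filter fun e : Sym2 (Fin n) => w e ≠ 0).card := by
    refine Finset.card_lt_card ⟨fun e he => ?_, fun hsub => ?_⟩
    · rw [Finset.mem_filter] at he ⊢
      refine ⟨he.1, fun hwe => he.2 ?_⟩
      simp only [hu, mem_setOf_eq]
      split_ifs <;> simp [hwe]
    · have hmem : s(y, v₀) ∈ (Finset.univ.filter fun e : Sym2 (Fin n) => w e ≠ 0) :=
        Finset.mem_filter.2 ⟨Finset.mem_univ _, hv₀⟩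
      have := Finset.mem_filter.1 (hsub hmem)
      apply this.2
      simp only [hu, mem_setOf_eq, Sym2.mem_iff, true_or, not_true_eq_false, if_false]
  set ν := prodBernoulli u with hν
  haveI : IsProbabilityMeasure ν := inferInstance
  have hfilt : ∀ (x : Fin n) (ξ : BondConfig (Fin n)),
      (A.filter fun z => (openGraph ξ).Reachable x z) = (A.filter fun z => ξ ∈ openConn x z) :=
    fun x ξ => Finset.filter_congr fun _ _ => Iff.rfl
  have e1 : ∀ x : Fin n, {ω : BondConfig (Fin n) | (A.filter fun z => (openGraph (ω ∩ {e | y ∉ e})).Reachable x z).card ≤ j} =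
      {ω : BondConfig (Fin n) | ω ∩ {e | y ∉ e} ∈ {ξ : BondConfig (Fin n) | (A.filter fun z => (openGraph ξ).Reachable x z).card ≤ j}} :=
    fun x => rfl
  have eoc : ∀ (x : Fin n), {ξ : BondConfig (Fin n) | (A.filter fun z => (openGraph ξ).Reachable x z).card ≤ j} =
      {ξ : BondConfig (Fin n) | (A.filter fun z => ξ ∈ openConn x z).card ≤ j} := by
    intro x; ext ξ
    exact ⟨fun h => by rw [mem_setOf_eq] at h ⊢; rwa [← hfilt x ξ], fun h => by rw [mem_setOf_eq] at h ⊢; rwa [hfilt x ξ]⟩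
  -- `u`-lightness of a vertex, and the champion `p` of `u` in `Reachable` form
  set sW : Fin n → ℝ := fun v => ν.real {ξ : BondConfig (Fin n) | (A.filter fun z => (openGraph ξ).Reachable v z).card ≤ j} with hsW
  have hpmax : ∀ a ∈ A, sW a ≤ sW p := by
    intro a ha; simp only [hsW]; rw [eoc a, eoc p]; exact hpch a ha
  -- ### the glued star-packing transfer with reference `p`
  rw [← hBeq]
  refine gluedSet_lsp_of_reference w A B' y p q c j hyA hpA hqA hcA hyB' ?_ (by rw [hBeq]; exact hcmp)
  -- ### the packing inequality at every star: stability or the induction hypothesis in `u`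
  intro S hS
  set S' : Finset (Fin n) := B' ∪ S with hS'
  have eP1 : {ω : BondConfig (Fin n) | (∀ m ∈ S', ¬ (openGraph (ω ∩ {e | y ∉ e})).Reachable p m) ∧
        1 ≤ (A.filter fun z => ∃ m ∈ S', (openGraph (ω ∩ {e | y ∉ e})).Reachable m z).card ∧
        (A.filter fun z => ∃ m ∈ S', (openGraph (ω ∩ {e | y ∉ e})).Reachable m z).card ≤ j} =
      {ω : BondConfig (Fin n) | ω ∩ {e | y ∉ e} ∈ {ξ : BondConfig (Fin n) | (∀ m ∈ S', ¬ (openGraph ξ).Reachable p m) ∧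
        1 ≤ (A.filter fun z => ∃ m ∈ S', (openGraph ξ).Reachable m z).card ∧
        (A.filter fun z => ∃ m ∈ S', (openGraph ξ).Reachable m z).card ≤ j}} := rfl
  have eP2 : {ω : BondConfig (Fin n) | ¬ 1 ≤ (A.filter fun z => ∃ m ∈ S', (openGraph (ω ∩ {e | y ∉ e})).Reachable m z).card ∧
        (A.filter fun z => (openGraph (ω ∩ {e | y ∉ e})).Reachable c z).card ≤ j} =
      {ω : BondConfig (Fin n) | ω ∩ {e | y ∉ e} ∈ {ξ : BondConfig (Fin n) |
        ¬ 1 ≤ (A.filter fun z => ∃ m ∈ S', (openGraph ξ).Reachable m z).card ∧ (A.filter fun z => (openGraph ξ).Reachable c z).card ≤ j}} := rfl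
  have eP3 : {ω : BondConfig (Fin n) | (∀ m ∈ S', ¬ (openGraph (ω ∩ {e | y ∉ e})).Reachable p m) ∧
        (A.filter fun z => (openGraph (ω ∩ {e | y ∉ e})).Reachable p z).card ≤ j} =
      {ω : BondConfig (Fin n) | ω ∩ {e | y ∉ e} ∈ {ξ : BondConfig (Fin n) | (∀ m ∈ S', ¬ (openGraph ξ).Reachable p m) ∧
        (A.filter fun z => (openGraph ξ).Reachable p z).card ≤ j}} := rfl
  rw [eP1, eP2, eP3, measureReal_preimage_avoid, measureReal_preimage_avoid, measureReal_preimage_avoid]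
  set MS : BondConfig (Fin n) → ℕ := fun ξ => (A.filter fun z => ∃ m ∈ S', (openGraph ξ).Reachable m z).card with hMS
  set Lx : Fin n → BondConfig (Fin n) → ℕ := fun x ξ => (A.filter fun z => (openGraph ξ).Reachable x z).card with hLx
  change ν.real {ξ | (∀ m ∈ S', ¬ (openGraph ξ).Reachable p m) ∧ 1 ≤ MS ξ ∧ MS ξ ≤ j} + ν.real {ξ | ¬ 1 ≤ MS ξ ∧ Lx c ξ ≤ j} ≤
    ν.real {ξ | (∀ m ∈ S', ¬ (openGraph ξ).Reachable p m) ∧ Lx p ξ ≤ j}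
  have hMS0 : ∀ ξ, ¬ 1 ≤ MS ξ → ∀ m ∈ S', ¬ (openGraph ξ).Reachable p m := by
    intro ξ h m hm hpm
    exact h (Finset.card_pos.2 ⟨p, Finset.mem_filter.2 ⟨hpA, m, hm, hpm.symm⟩⟩)
  by_cases hpS : p ∈ S'
  · -- `p ∈ S'`: `p ≁ S'` is impossible and `|π(S')| ≥ 1`
    have h1 : ν.real {ξ | (∀ m ∈ S', ¬ (openGraph ξ).Reachable p m) ∧ 1 ≤ MS ξ ∧ MS ξ ≤ j} = 0 := by
      have : {ξ | (∀ m ∈ S', ¬ (openGraph ξ).Reachable p m) ∧ 1 ≤ MS ξ ∧ MS ξ ≤ j} = (∅ : Set (BondConfig (Fin n))) := by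
        ext ξ; simp only [mem_setOf_eq, mem_empty_iff_false, iff_false, not_and]
        intro h; exact absurd (SimpleGraph.Reachable.refl p) (h p hpS)
      rw [this, measureReal_empty]
    have h2 : ν.real {ξ | ¬ 1 ≤ MS ξ ∧ Lx c ξ ≤ j} = 0 := by
      have : {ξ | ¬ 1 ≤ MS ξ ∧ Lx c ξ ≤ j} = (∅ : Set (BondConfig (Fin n))) := by
        ext ξ; simp only [mem_setOf_eq, mem_empty_iff_false, iff_false, not_and]
        intro h; exact absurd (SimpleGraph.Reachable.refl p) (hMS0 ξ h p hpS)
      rw [this, measureReal_empty]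
    rw [h1, h2, add_zero]; exact measureReal_nonneg
  by_cases hdm : ∃ m ∈ S', sW m ≤ sW p
  · -- #### a member no `u`-lighter than `p`: unguarded stability
    obtain ⟨m, hmS, hm⟩ := hdm
    have hpm : p ≠ m := fun h => hpS (h ▸ hmS)
    have key := unguardedStability_of_member u A S' hmS hpm j hm
    change ν.real {ξ | (∀ m ∈ S', ¬ (openGraph ξ).Reachable p m) ∧ MS ξ ≤ j} ≤
      ν.real {ξ | (∀ m ∈ S', ¬ (openGraph ξ).Reachable p m) ∧ Lx p ξ ≤ j} at key
    have hdisj : Disjoint {ξ | (∀ m ∈ S', ¬ (openGraph ξ).Reachable p m) ∧ 1 ≤ MS ξ ∧ MS ξ ≤ j} {ξ | ¬ 1 ≤ MS ξ ∧ Lx c ξ ≤ j} := by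
      rw [Set.disjoint_left]
      rintro ξ ⟨_, h1, _⟩ ⟨h2, _⟩
      exact h2 h1
    have hsub : {ξ | (∀ m ∈ S', ¬ (openGraph ξ).Reachable p m) ∧ 1 ≤ MS ξ ∧ MS ξ ≤ j} ∪ {ξ | ¬ 1 ≤ MS ξ ∧ Lx c ξ ≤ j} ⊆
        {ξ | (∀ m ∈ S', ¬ (openGraph ξ).Reachable p m) ∧ MS ξ ≤ j} := by
      rintro ξ (⟨h1, _, h3⟩ | ⟨h1, _⟩)
      · exact ⟨h1, h3⟩
      · exact ⟨hMS0 ξ h1, by show MS ξ ≤ j; omega⟩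
    have hu' := measureReal_union hdisj (MeasurableSet.of_discrete (s := {ξ | ¬ 1 ≤ MS ξ ∧ Lx c ξ ≤ j})) (μ := ν)
      (measure_ne_top _ _) (measure_ne_top _ _)
    rw [← hu']
    exact (measureReal_mono hsub (measure_ne_top _ _)).trans key
  · -- #### all members of `S'` are non-relays `u`-lighter than `p`: the induction hypothesis in `u`
    push Not at hdm
    have hS'A : ∀ m ∈ S', m ∉ A := by
      intro m hm hmA
      exact absurd (hpmax m hmA) (not_le.2 (hdm m hm))
    have hS'ne : S'.Nonempty := by
      obtain ⟨m, hm⟩ := hB'ne; exact ⟨m, Finset.mem_union_left _ hm⟩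
    have hpch' : ∀ a ∈ A, ν.real {ξ : BondConfig (Fin n) | (A.filter fun z => ξ ∈ openConn a z).card ≤ j} ≤
        ν.real {ξ : BondConfig (Fin n) | (A.filter fun z => ξ ∈ openConn p z).card ≤ j} := hpch
    have hIH := ih n u A S' p c j hlt hpA hcA hS'ne hS'A hpch'
    have hfiltS : ∀ (ξ : BondConfig (Fin n)),
        (A.filter fun z => ∃ m ∈ S', (openGraph ξ).Reachable m z) = (A.filter fun z => ∃ m ∈ S', ξ ∈ openConn m z) :=
      fun ξ => Finset.filter_congr fun _ _ => Iff.rfl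
    have eL : {ξ : BondConfig (Fin n) | (∀ m ∈ S', ξ ∉ openConn p m) ∧ 1 ≤ (A.filter fun z => ∃ m ∈ S', ξ ∈ openConn m z).card ∧
          (A.filter fun z => ∃ m ∈ S', ξ ∈ openConn m z).card ≤ j} = {ξ | (∀ m ∈ S', ¬ (openGraph ξ).Reachable p m) ∧ 1 ≤ MS ξ ∧ MS ξ ≤ j} := by
      ext ξ; simp only [mem_setOf_eq, hMS, hfiltS ξ]; exact Iff.rfl
    have eZ : {ξ : BondConfig (Fin n) | ¬ 1 ≤ (A.filter fun z => ∃ m ∈ S', ξ ∈ openConn m z).card ∧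
          (A.filter fun z => ξ ∈ openConn c z).card ≤ j} = {ξ | ¬ 1 ≤ MS ξ ∧ Lx c ξ ≤ j} := by
      ext ξ; simp only [mem_setOf_eq, hMS, hLx, hfiltS ξ, hfilt c ξ]
    have eR : {ξ : BondConfig (Fin n) | (∀ m ∈ S', ξ ∉ openConn p m) ∧ (A.filter fun z => ξ ∈ openConn p z).card ≤ j} =
        {ξ | (∀ m ∈ S', ¬ (openGraph ξ).Reachable p m) ∧ Lx p ξ ≤ j} := by
      ext ξ; simp only [mem_setOf_eq, hLx, hfilt p ξ]; exact Iff.rfl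
    rw [eL, eZ, eR] at hIH
    exact hIH

/-- **The NON-INFORMATIVE gluing step.**  In the same setting, if the champion `q` is also a champion of the GLUED lightness
(`μ(G_a) ≤ μ(G_q)` for every relay `a`, `G_a` = "`a` light in `w/B`"), then LSP(w, q, c, B): the residual gluing hypothesis
`hGlue` of `noHeavyLowerTail_of_gluedChampion_open` only needs proof when gluing `B` DETHRONES `q`.
[cite: KozmaNitzan2024, Lemma 5 and Thm. 4 (pp. 13–14)] -/
theorem gluedSet_lsp_of_gluedChampion (w : Sym2 (Fin n) → unitInterval) (A B : Finset (Fin n)) (q c : Fin n) (j : ℕ)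
    (ih : ∀ (n' : ℕ) (w' : Sym2 (Fin n') → unitInterval) (A' B' : Finset (Fin n')) (q' c' : Fin n') (j' : ℕ),
      (Finset.univ.filter fun e : Sym2 (Fin n') => w' e ≠ 0).card < (Finset.univ.filter fun e : Sym2 (Fin n) => w e ≠ 0).card →
      q' ∈ A' → c' ∈ A' → B'.Nonempty → (∀ m ∈ B', m ∉ A') →
      (∀ a ∈ A', (prodBernoulli w').real {ω : BondConfig (Fin n') | (A'.filter fun x => ω ∈ openConn a x).card ≤ j'} ≤
        (prodBernoulli w').real {ω : BondConfig (Fin n') | (A'.filter fun x => ω ∈ openConn q' x).card ≤ j'}) →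
      (prodBernoulli w').real {ω : BondConfig (Fin n') | (∀ m ∈ B', ω ∉ openConn q' m) ∧
          1 ≤ (A'.filter fun z => ∃ m ∈ B', ω ∈ openConn m z).card ∧ (A'.filter fun z => ∃ m ∈ B', ω ∈ openConn m z).card ≤ j'} +
        (prodBernoulli w').real {ω : BondConfig (Fin n') | ¬ 1 ≤ (A'.filter fun z => ∃ m ∈ B', ω ∈ openConn m z).card ∧
          (A'.filter fun z => ω ∈ openConn c' z).card ≤ j'} ≤
      (prodBernoulli w').real {ω : BondConfig (Fin n') | (∀ m ∈ B', ω ∉ openConn q' m) ∧ (A'.filter fun z => ω ∈ openConn q' z).card ≤ j'})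
    (hqA : q ∈ A) (hcA : c ∈ A) (hBA : ∀ m ∈ B, m ∉ A) (hB2 : 2 ≤ B.card) (hpos : ∃ y ∈ B, ∃ v, v ≠ y ∧ w s(y, v) ≠ 0)
    (hgch : ∀ a ∈ A, (prodBernoulli w).real {ω : BondConfig (Fin n) |
        ((∃ m ∈ B, ω ∈ openConn a m) → (A.filter fun z => ∃ m ∈ B, ω ∈ openConn m z).card ≤ j) ∧
          ((∀ m ∈ B, ω ∉ openConn a m) → (A.filter fun z => ω ∈ openConn a z).card ≤ j)} ≤
      (prodBernoulli w).real {ω : BondConfig (Fin n) |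
        ((∃ m ∈ B, ω ∈ openConn q m) → (A.filter fun z => ∃ m ∈ B, ω ∈ openConn m z).card ≤ j) ∧
          ((∀ m ∈ B, ω ∉ openConn q m) → (A.filter fun z => ω ∈ openConn q z).card ≤ j)}) :
    (prodBernoulli w).real {ω : BondConfig (Fin n) | (∀ m ∈ B, ω ∉ openConn q m) ∧
        1 ≤ (A.filter fun z => ∃ m ∈ B, ω ∈ openConn m z).card ∧ (A.filter fun z => ∃ m ∈ B, ω ∈ openConn m z).card ≤ j} +
      (prodBernoulli w).real {ω : BondConfig (Fin n) | ¬ 1 ≤ (A.filter fun z => ∃ m ∈ B, ω ∈ openConn m z).card ∧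
        (A.filter fun z => ω ∈ openConn c z).card ≤ j} ≤
      (prodBernoulli w).real {ω : BondConfig (Fin n) | (∀ m ∈ B, ω ∉ openConn q m) ∧ (A.filter fun z => ω ∈ openConn q z).card ≤ j} := by
  obtain ⟨y, hyB, hy⟩ := hpos
  set u : Sym2 (Fin n) → unitInterval := fun e => if e ∈ {e : Sym2 (Fin n) | y ∉ e} then w e else 0 with hu
  -- a champion `p` of `u`
  set sU : Fin n → ℝ := fun v => (prodBernoulli u).real {ξ : BondConfig (Fin n) | (A.filter fun z => ξ ∈ openConn v z).card ≤ j}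
    with hsU
  obtain ⟨p, hpA, hpmax⟩ := Finset.exists_max_image A sU ⟨q, hqA⟩
  exact gluedSet_lsp_of_subchampion w A B y p q c j ih hqA hcA hBA hyB hB2 hy hpA hpmax (hgch p hpA)

end Summit.CriticalPhenomena.PercolationContinuityZ3.Theorems

end
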